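import Mathlib
import Literature.GroupTheory.CombinatorialGroupTheory.FreeGroupCentralizers

/-!
# Quandle blindness of meridian-free surface links — the group-theoretic core

Solo-informed seat (SmoothPoincare4), isotopy line on HKM24 Question 1.4 (`𝔐₀ ≅ S⁴ ⟸ P* split`),
seat records THEOREM Q (CLAIMS C1040, `paper/doors-for-M0.md` §4, `paper/sharpest-statement.md` (36)).

TOPOLOGY (markdown, [P∧L]): let `L = F₁ ⊔ … ⊔ Fₙ ⊂ S⁴` be a surface-link whose group
`π = π₁(S⁴ ∖ L)` is FREE on one meridian `mᵢ` per component — e.g. the tunnel page-torus pair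
`P* = T₁ ⊔ T₂ ⊂ (S⁴, τ⁷T(2,3))` of the seat's split door, `π = F(m₁, m₂)`.  The peripheral subgroup
`Pᵢ = im(π₁(∂νFᵢ) → π)` contains `mᵢ` as a CENTRAL element (the fibre class of `∂νFᵢ = Fᵢ × S¹`),
so `Pᵢ` lies in the centralizer of the basis element `mᵢ`, which in a free group is `⟨mᵢ⟩`
(`Literature…FreeGroup.centralizer_of_eq_zpowers`): **`Pᵢ = ⟨mᵢ⟩`**
(`SoloInformed_peripheral_eq_zpowers`).  By Joyce–Matveev / Fenn–Rourke the fundamental quandle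
is the coset quandle `⊔ᵢ (⟨mᵢ⟩\π ; mᵢ)`, `(Pᵢ g) ◁ (Pⱼ h) = Pᵢ g h⁻¹ mⱼ h`; the map
`Pᵢ g ↦ g⁻¹ mᵢ g` is well defined and injective on cosets exactly because `Z(mᵢ) = ⟨mᵢ⟩`
(`SoloInformed_conj_of_eq_iff`), lands in pairwise distinct conjugacy classes
(`SoloInformed_not_isConj_of`) and intertwines the coset operation with conjugation
(`SoloInformed_coset_op_conj`), so `Q(L)` is the conjugation quandle on the conjugacy classes of
the basis — Joyce's model of the FREE quandle `FQₙ = Q(unlink)`.  Farinati–Guccione–Guccione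
(Comm. Algebra 42 (2014), Thm 4.1) prove `H^Q_k(FQₙ) = 0` for `k ≥ 2`, hence the fundamental class
`[L] ∈ H^Q_3(Q(L))` vanishes and every CJKLS quandle 3-cocycle invariant of `L` equals the unlink's
(`|X|ⁿ · 0`); colouring numbers are `|X|ⁿ`.  For the seat: the quandle-cocycle door on `P*` is dead
by theorem.  This file certifies the four group-theoretic steps; the quandle homology input is
literature.
-/

namespace Summit.SmoothPoincare4.SmoothPoincare4.Theorems

open Subgroup

universe u

/-- **Peripheral subgroups of a meridian-free surface link are cyclic.**  A subgroup of a free group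
containing a basis element `a` that commutes with all of the subgroup is `⟨a⟩`. -/
theorem SoloInformed_peripheral_eq_zpowers {α : Type u} (a : α) (P : Subgroup (FreeGroup α))
    (ha : FreeGroup.of a ∈ P) (hcomm : ∀ p ∈ P, p * FreeGroup.of a = FreeGroup.of a * p) :
    P = zpowers (FreeGroup.of a) := by
  refine le_antisymm ?_ ?_
  · intro p hp
    rw [← Literature.GroupTheory.CombinatorialGroupTheory.FreeGroup.centralizer_of_eq_zpowers a,
      Subgroup.mem_centralizer_singleton_iff]
    exact hcomm p hp
  · rw [Subgroup.zpowers_le]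
    exact ha

/-- **The coset-to-conjugate map is well defined and injective on cosets of `⟨a⟩`.**
`g⁻¹ a g = h⁻¹ a h ↔ h g⁻¹ ∈ ⟨a⟩` for a basis element `a` of a free group. -/
theorem SoloInformed_conj_of_eq_iff {α : Type u} (a : α) (g h : FreeGroup α) :
    g⁻¹ * FreeGroup.of a * g = h⁻¹ * FreeGroup.of a * h ↔
      h * g⁻¹ ∈ zpowers (FreeGroup.of a) := by
  rw [← Literature.GroupTheory.CombinatorialGroupTheory.FreeGroup.centralizer_of_eq_zpowers a,
    Subgroup.mem_centralizer_singleton_iff]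
  constructor
  · intro hconj
    -- `a (h g⁻¹) = (h g⁻¹) a`
    have : h * (g⁻¹ * FreeGroup.of a * g) * g⁻¹ = h * (h⁻¹ * FreeGroup.of a * h) * g⁻¹ := by
      rw [hconj]
    have h2 : h * (g⁻¹ * FreeGroup.of a * g) * g⁻¹ = h * g⁻¹ * FreeGroup.of a := by group
    have h3 : h * (h⁻¹ * FreeGroup.of a * h) * g⁻¹ = FreeGroup.of a * (h * g⁻¹) := by group
    rw [h2, h3] at this
    exact this
  · intro hc
    -- from `a (h g⁻¹) = (h g⁻¹) a`
    have h2 : g⁻¹ * FreeGroup.of a * g = h⁻¹ * (h * g⁻¹ * FreeGroup.of a) * g := by group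
    rw [h2, hc]
    group

/-- The right-hand class of the relation in `SoloInformed_conj_of_eq_iff` is the right coset
relation of `⟨a⟩`, so `⟨a⟩ g ↦ g⁻¹ a g` is a bijection from right cosets onto the conjugacy class
of `a`. -/
theorem SoloInformed_conj_of_eq_iff_rightRel {α : Type u} (a : α) (g h : FreeGroup α) :
    g⁻¹ * FreeGroup.of a * g = h⁻¹ * FreeGroup.of a * h ↔
      QuotientGroup.rightRel (zpowers (FreeGroup.of a)) g h := by
  rw [SoloInformed_conj_of_eq_iff, QuotientGroup.rightRel_apply]

/-- **Distinct basis elements of a free group are not conjugate** (seen in the abelian quotient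
`ℤ` that counts the letter `a`), so the components of the coset quandle land in distinct
conjugacy classes. -/
theorem SoloInformed_not_isConj_of {α : Type u} [DecidableEq α] {a b : α} (hab : a ≠ b) :
    ¬ IsConj (FreeGroup.of a) (FreeGroup.of b) := by
  intro h
  obtain ⟨σ, hσa, hσ⟩ :=
    Literature.GroupTheory.CombinatorialGroupTheory.FreeGroup.exists_hom_of_eq_one a
  have h1 : IsConj (σ (FreeGroup.of a)) (σ (FreeGroup.of b)) := σ.map_isConj h
  rw [isConj_iff_eq, hσa, hσ b (Ne.symm hab)] at h1
  exact absurd (congrArg Multiplicative.toAdd h1) (by simp)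

/-- **The coset operation is conjugation.**  Under `P g ↦ g⁻¹ x g` the Joyce–Matveev coset
operation `(P g) ◁ (P' h) = P (g h⁻¹ y h)` becomes conjugation of `g⁻¹ x g` by `h⁻¹ y h`
(any group). -/
theorem SoloInformed_coset_op_conj {G : Type u} [Group G] (x y g h : G) :
    (g * h⁻¹ * y * h)⁻¹ * x * (g * h⁻¹ * y * h) =
      (h⁻¹ * y * h)⁻¹ * (g⁻¹ * x * g) * (h⁻¹ * y * h) := by
  group

/-- Every element of the conjugacy class of a basis element is hit: surjectivity of
`⟨a⟩ g ↦ g⁻¹ a g` onto `{x | IsConj (of a) x}` (tautological, recorded for completeness). -/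
theorem SoloInformed_conj_of_surj {α : Type u} (a : α) (x : FreeGroup α)
    (hx : IsConj (FreeGroup.of a) x) : ∃ g : FreeGroup α, g⁻¹ * FreeGroup.of a * g = x := by
  obtain ⟨c, hc⟩ := isConj_iff.1 hx
  exact ⟨c⁻¹, by simpa [mul_assoc] using hc⟩

end Summit.SmoothPoincare4.SmoothPoincare4.Theorems
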